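import Literature.MathematicalPhysics.StatisticalMechanics.Crystallization
import HarnessLib

/-!
# Sticky particles on a line: ground states are unit chains

Topic: `Literature/MathematicalPhysics/StatisticalMechanics`. The one-dimensional case of the
Heitmann–Radin sticky-potential mechanism ("the crystallization problem is thus equivalent to the
sphere packing [problem]", Blanc–Lewin 2015, §2.3 (24)), in the setting of `Crystallization.lean`
(`interactionEnergy`, `groundStateEnergy`, `IsGroundState`: configurations of *distinct* points,
real-valued pair potentials).

## Content

* `stickyPotential r = 1 (r < 1), -1 (r = 1), 0 (r > 1)` — the sticky potential (24) of
  Blanc–Lewin 2015 with the hard core `+∞` replaced by the finite penalty `1` (potentials are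
  real-valued here); bounded below by `-1`.
* Combinatorics of `N` distinct reals `t₁, …, t_N` (`StickyChain.unitPairs`, the pairs at
  distance exactly `1`): at most `N - 1` such pairs (`StickyChain.card_unitPairs_le`: the left
  endpoint of a unit pair determines it and is never the top particle); if there are `N - 1` of
  them every particle but the top one has a partner at `+1`; `1`-separated points in `[a, a+k]`
  number at most `k + 1`; hence (`StickyChain.exists_apply_eq_min_add`) extremal separated
  configurations are the chains `a, a + 1, …, a + (N - 1)`.
* Energies in `ℝ¹`: `𝓔_N = #{pairs closer than 1} - #{pairs at distance 1}`
  (`StickyChain.interactionEnergy_stickyPotential`), so `𝓔_N ≥ -(N - 1)` with equality for the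
  chain (`StickyChain.interactionEnergy_chain`); **`E(N) = -(N - 1)`**
  (`groundStateEnergy_stickyPotential_one`) and **every ground state is a unit chain with all
  mutual distances `≥ 1`** (`IsGroundState.exists_eq_add_of_stickyPotential`).

The crystallization statements proper (`IsCrystallizing stickyPotential 1`,
`HasPeriodicGroundStateEnergy stickyPotential 1`) are in `StickyChainCrystallization.lean`.

## Sources

* X. Blanc, M. Lewin, *The crystallization conjecture: a review*, EMS Surv. Math. Sci. 2 (2015),
  255–306, arXiv:1504.01153: §2.3, (24) (sticky potential; `d = 1` "rather well understood").
* R. C. Heitmann, C. Radin, *The ground state for sticky disks*, J. Stat. Phys. 22 (1980),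
  281–287 (the two-dimensional theorem; cited for the mechanism only).

## Design notes

* The finite core changes nothing in `d = 1`: a pair closer than `1` costs `+1 > 0` while the
  number of unit pairs is bounded by `N - 1` independently, so minimisers have no such pair
  (proved, not assumed). In `d ≥ 2` a finite core does change the problem; nothing here is
  claimed beyond the line.
* Everything is elementary counting; no measure theory. [folklore] throughout, the potential is
  cited to Blanc–Lewin 2015, (24).
-/

noncomputable section

open scoped BigOperators Topology
open Filter Set Metric

namespace Literature.MathematicalPhysics.StatisticalMechanics

variable {d : ℕ}

/-! ## The sticky potential -/

/-- The **sticky potential** `V(r) = 1` for `r < 1`, `V(1) = -1`, `V(r) = 0` for `r > 1`: the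
sticky-sphere potential of Heitmann–Radin as printed in Blanc–Lewin 2015, (24), except that the
hard core `V = +∞` on `[0, 1)` is replaced by the finite penalty `1` (pair potentials are
real-valued in `Crystallization.lean`; in `d = 1` the ground states are unchanged, see
`IsGroundState.exists_eq_add_of_stickyPotential`). [cite: BlancLewin2015, §2.3 (24)] -/
def stickyPotential (r : ℝ) : ℝ :=
  if r < 1 then 1 else if r = 1 then -1 else 0

/-- `V = 𝟙_{r<1} - 𝟙_{r=1}`. [folklore] -/
theorem stickyPotential_eq (r : ℝ) :
    stickyPotential r = (if r < 1 then 1 else 0) - (if r = 1 then 1 else 0) := by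
  unfold stickyPotential
  split_ifs with h1 h2 <;> norm_num
  linarith

/-- The sticky potential is bounded below by `-1`. [folklore] -/
theorem neg_one_le_stickyPotential (r : ℝ) : -1 ≤ stickyPotential r := by
  unfold stickyPotential
  split_ifs <;> norm_num

/-- `V(1) = -1` (contact). [folklore] -/
theorem stickyPotential_one : stickyPotential 1 = -1 := by
  norm_num [stickyPotential]

/-- `V(r) = 0` for `r > 1` (zero range beyond contact). [folklore] -/
theorem stickyPotential_of_one_lt {r : ℝ} (h : 1 < r) : stickyPotential r = 0 := by
  simp [stickyPotential, not_lt.2 h.le, ne_of_gt h]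

/-- `V(r) = 1` for `r < 1` (core penalty). [folklore] -/
theorem stickyPotential_of_lt_one {r : ℝ} (h : r < 1) : stickyPotential r = 1 := by
  simp [stickyPotential, h]

/-- For any configuration in any dimension the sticky energy is
`#{pairs closer than 1} - #{pairs at distance exactly 1}`. [folklore] -/
theorem interactionEnergy_stickyPotential {N : ℕ} (x : Fin N → EuclideanSpace ℝ (Fin d)) :
    interactionEnergy stickyPotential x =
      (∑ i, ∑ j ∈ Finset.Ioi i, if dist (x i) (x j) < 1 then (1 : ℝ) else 0) -
        ∑ i, ∑ j ∈ Finset.Ioi i, if dist (x i) (x j) = 1 then (1 : ℝ) else 0 := by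
  simp only [interactionEnergy, stickyPotential_eq, Finset.sum_sub_distrib]

/-- The core part of the sticky energy is non-negative. [folklore] -/
theorem sum_ite_dist_lt_one_nonneg {N : ℕ} (x : Fin N → EuclideanSpace ℝ (Fin d)) :
    0 ≤ ∑ i, ∑ j ∈ Finset.Ioi i, if dist (x i) (x j) < 1 then (1 : ℝ) else 0 :=
  Finset.sum_nonneg fun _ _ => Finset.sum_nonneg fun _ _ => by split_ifs <;> norm_num

/-- The core part vanishes iff all mutual distances are `≥ 1`. [folklore] -/
theorem sum_ite_dist_lt_one_eq_zero_iff {N : ℕ} (x : Fin N → EuclideanSpace ℝ (Fin d)) :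
    (∑ i, ∑ j ∈ Finset.Ioi i, if dist (x i) (x j) < 1 then (1 : ℝ) else 0) = 0 ↔
      ∀ i j, i ≠ j → 1 ≤ dist (x i) (x j) := by
  rw [Finset.sum_eq_zero_iff_of_nonneg fun i _ =>
    Finset.sum_nonneg fun j _ => by split_ifs <;> norm_num]
  simp only [Finset.mem_univ, true_implies]
  constructor
  · intro h i j hij
    rcases lt_or_gt_of_ne hij with hlt | hlt
    · have := (Finset.sum_eq_zero_iff_of_nonneg fun j _ => by split_ifs <;> norm_num).1 (h i) j
        (Finset.mem_Ioi.2 hlt)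
      by_contra hc
      rw [if_pos (not_le.1 hc)] at this
      exact one_ne_zero this
    · have := (Finset.sum_eq_zero_iff_of_nonneg fun j _ => by split_ifs <;> norm_num).1 (h j) i
        (Finset.mem_Ioi.2 hlt)
      by_contra hc
      rw [dist_comm, if_pos (not_le.1 hc)] at this
      exact one_ne_zero this
  · intro h i
    exact Finset.sum_eq_zero fun j hj =>
      if_neg (not_lt.2 (h i j (ne_of_lt (Finset.mem_Ioi.1 hj))))

/-! ## The line `ℝ¹` and unit pairs -/

namespace StickyChain

/-- Distance on the line `ℝ¹ = EuclideanSpace ℝ (Fin 1)` is the distance of coordinates.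
[folklore] -/
theorem dist_eq_abs_sub (v w : EuclideanSpace ℝ (Fin 1)) : dist v w = |v 0 - w 0| := by
  rw [EuclideanSpace.dist_eq, Fin.sum_univ_one, Real.sqrt_sq_eq_abs, Real.dist_eq, abs_abs]

/-- The norm on `ℝ¹` is the absolute value of the coordinate. [folklore] -/
theorem norm_eq_abs (v : EuclideanSpace ℝ (Fin 1)) : ‖v‖ = |v 0| := by
  rw [← dist_zero_right, dist_eq_abs_sub]; simp

/-- Points of `ℝ¹` with the same coordinate are equal. [folklore] -/
theorem ext_zero {v w : EuclideanSpace ℝ (Fin 1)} (h : v 0 = w 0) : v = w := by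
  ext i; fin_cases i; exact h

/-- Distinct points of `ℝ¹` have distinct coordinates. [folklore] -/
theorem injective_coord {N : ℕ} {x : Fin N → EuclideanSpace ℝ (Fin 1)}
    (hx : Function.Injective x) : Function.Injective fun i => x i 0 :=
  fun _ _ h => hx (ext_zero h)

section UnitPairs

variable {N : ℕ} {t : Fin N → ℝ}

open scoped Classical in
/-- The ordered index pairs `(i, j)`, `i < j`, whose coordinates differ by exactly `1` ("unit
pairs", the contacts of the sticky potential). [folklore] -/
def unitPairs (t : Fin N → ℝ) : Finset (Fin N × Fin N) :=
  Finset.univ.filter fun p => p.1 < p.2 ∧ |t p.1 - t p.2| = 1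

/-- The index of the left endpoint (smaller coordinate) of a pair. [folklore] -/
def lowerEnd (t : Fin N → ℝ) (p : Fin N × Fin N) : Fin N := if t p.1 < t p.2 then p.1 else p.2

/-- The index of the right endpoint (larger coordinate) of a pair. [folklore] -/
def upperEnd (t : Fin N → ℝ) (p : Fin N × Fin N) : Fin N := if t p.1 < t p.2 then p.2 else p.1

/-- Membership in `unitPairs`. [folklore] -/
theorem mem_unitPairs {p : Fin N × Fin N} :
    p ∈ unitPairs t ↔ p.1 < p.2 ∧ |t p.1 - t p.2| = 1 := by
  classical
  simp [unitPairs]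

/-- In a unit pair the right endpoint sits at the left endpoint `+ 1`. [folklore] -/
theorem apply_upperEnd (ht : Function.Injective t) {p : Fin N × Fin N} (hp : p ∈ unitPairs t) :
    t (upperEnd t p) = t (lowerEnd t p) + 1 := by
  obtain ⟨hlt, habs⟩ := mem_unitPairs.1 hp
  have hne : t p.1 ≠ t p.2 := fun e => (ne_of_lt hlt) (ht e)
  unfold upperEnd lowerEnd
  split_ifs with h
  · rw [abs_sub_comm, abs_of_pos (sub_pos.2 h)] at habs
    linarith
  · rw [abs_of_pos (sub_pos.2 (lt_of_le_of_ne (not_lt.1 h) (Ne.symm hne)))] at habs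
    linarith

/-- A unit pair is determined by its left endpoint (the right one is the unique particle at
`+1`). [folklore] -/
theorem lowerEnd_injOn (ht : Function.Injective t) : Set.InjOn (lowerEnd t) ↑(unitPairs t) := by
  intro p hp q hq h
  have hu : upperEnd t p = upperEnd t q :=
    ht (by rw [apply_upperEnd ht hp, apply_upperEnd ht hq, h])
  have hp1 := (mem_unitPairs.1 hp).1
  have hq1 := (mem_unitPairs.1 hq).1
  unfold lowerEnd at h
  unfold upperEnd at hu
  by_cases h1 : t p.1 < t p.2 <;> by_cases h2 : t q.1 < t q.2 <;>
    simp only [h1, h2, ↓reduceIte] at h hu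
  · exact Prod.ext h hu
  · have : q.2 < q.1 := by rw [← h, ← hu]; exact hp1
    exact absurd hq1 (lt_asymm this)
  · have : q.2 < q.1 := by rw [← h, ← hu]; exact hp1
    exact absurd hq1 (lt_asymm this)
  · exact Prod.ext hu h

/-- The left endpoint of a unit pair is never a particle with maximal coordinate. [folklore] -/
theorem lowerEnd_mem_erase (ht : Function.Injective t) {i₀ : Fin N} (hi₀ : ∀ j, t j ≤ t i₀)
    {p : Fin N × Fin N} (hp : p ∈ unitPairs t) : lowerEnd t p ∈ Finset.univ.erase i₀ := by
  refine Finset.mem_erase.2 ⟨fun h => ?_, Finset.mem_univ _⟩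
  have h1 := apply_upperEnd ht hp
  have h2 := hi₀ (upperEnd t p)
  rw [h] at h1
  linarith

/-- **Among `N` distinct points of a line at most `N - 1` pairs are at distance exactly `1`**
(`i₀` a particle with maximal coordinate). [folklore] -/
theorem card_unitPairs_le (ht : Function.Injective t) {i₀ : Fin N} (hi₀ : ∀ j, t j ≤ t i₀) :
    (unitPairs t).card ≤ N - 1 := by
  calc (unitPairs t).card ≤ (Finset.univ.erase i₀).card :=
        Finset.card_le_card_of_injOn (lowerEnd t) (fun p hp => lowerEnd_mem_erase ht hi₀ hp)
          (lowerEnd_injOn ht)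
    _ = N - 1 := by
        rw [Finset.card_erase_of_mem (Finset.mem_univ _), Finset.card_univ, Fintype.card_fin]

/-- In the extremal case `#unitPairs ≥ N - 1` every particle except the top one has a partner
at `+1`. [folklore] -/
theorem exists_apply_eq_add_one (ht : Function.Injective t) {i₀ : Fin N} (hi₀ : ∀ j, t j ≤ t i₀)
    (hcard : N - 1 ≤ (unitPairs t).card) {i : Fin N} (hi : i ≠ i₀) : ∃ j, t j = t i + 1 := by
  classical
  have hsub : (unitPairs t).image (lowerEnd t) ⊆ Finset.univ.erase i₀ := by
    intro k hk
    obtain ⟨p, hp, rfl⟩ := Finset.mem_image.1 hk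
    exact lowerEnd_mem_erase ht hi₀ hp
  have hcard' : (Finset.univ.erase i₀).card ≤ ((unitPairs t).image (lowerEnd t)).card := by
    rw [Finset.card_image_of_injOn (lowerEnd_injOn ht), Finset.card_erase_of_mem (Finset.mem_univ _),
      Finset.card_univ, Fintype.card_fin]
    exact hcard
  have heq := Finset.eq_of_subset_of_card_le hsub hcard'
  have hi' : i ∈ (unitPairs t).image (lowerEnd t) := by
    rw [heq]; exact Finset.mem_erase.2 ⟨hi, Finset.mem_univ _⟩
  obtain ⟨p, hp, hpi⟩ := Finset.mem_image.1 hi'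
  exact ⟨upperEnd t p, hpi ▸ apply_upperEnd ht hp⟩

/-- `N` points with mutual distances `≥ 1` in an interval `[a, a + k]` number at most `k + 1`
(their integer parts relative to `a` are distinct). [folklore] -/
theorem card_le_of_one_le_abs_sub {a : ℝ} {k : ℕ} (hsep : ∀ i j, i ≠ j → 1 ≤ |t i - t j|)
    (hlo : ∀ i, a ≤ t i) (hhi : ∀ i, t i ≤ a + k) : N ≤ k + 1 := by
  classical
  have key : Set.InjOn (fun i => ⌊t i - a⌋₊) ↑(Finset.univ : Finset (Fin N)) := by
    intro i _ j _ h
    by_contra hij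
    have h1 := hsep i j hij
    have hi0 : (0 : ℝ) ≤ t i - a := sub_nonneg.2 (hlo i)
    have hj0 : (0 : ℝ) ≤ t j - a := sub_nonneg.2 (hlo j)
    have hi1 := Nat.floor_le hi0
    have hi2 := Nat.lt_floor_add_one (t i - a)
    have hj1 := Nat.floor_le hj0
    have hj2 := Nat.lt_floor_add_one (t j - a)
    have h' : (⌊t i - a⌋₊ : ℝ) = ⌊t j - a⌋₊ := by exact_mod_cast h
    rw [h'] at hi1 hi2
    have : |t i - t j| < 1 := by
      rw [abs_sub_lt_iff]; constructor <;> linarith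
    linarith
  have hmaps : ∀ i ∈ (Finset.univ : Finset (Fin N)),
      (fun i => ⌊t i - a⌋₊) i ∈ Finset.range (k + 1) := by
    intro i _
    rw [Finset.mem_range]
    refine (Nat.floor_lt (sub_nonneg.2 (hlo i))).2 ?_
    push_cast
    linarith [hhi i]
  have := Finset.card_le_card_of_injOn _ hmaps key
  simpa using this

/-- **Extremal configurations are unit chains.** If all mutual distances are `≥ 1` and every
particle but the top one `i₀` has a partner at `+1`, the coordinates are
`t i₁, t i₁ + 1, …, t i₁ + (N - 1)`, `i₁` a particle with minimal coordinate. [folklore] -/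
theorem exists_apply_eq_min_add {i₀ i₁ : Fin N}
    (hi₀ : ∀ j, t j ≤ t i₀) (hi₁ : ∀ j, t i₁ ≤ t j)
    (hsucc : ∀ i, i ≠ i₀ → ∃ j, t j = t i + 1) (hsep : ∀ i j, i ≠ j → 1 ≤ |t i - t j|) :
    ∀ k : ℕ, k < N → ∃ i, t i = t i₁ + k := by
  intro k
  induction k with
  | zero => exact fun _ => ⟨i₁, by simp⟩
  | succ k ih =>
    intro hk
    obtain ⟨i, hi⟩ := ih (Nat.lt_of_succ_lt hk)
    by_cases hii : i = i₀
    · subst hii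
      have := card_le_of_one_le_abs_sub hsep hi₁ (fun j => hi ▸ hi₀ j)
      omega
    · obtain ⟨j, hj⟩ := hsucc i hii
      exact ⟨j, by rw [hj, hi]; push_cast; ring⟩

/-- Conversely, if the `N` distinct coordinates contain `a, a + 1, …, a + (N - 1)`, each of them
is of this form. [folklore] -/
theorem exists_lt_apply_eq_add (ht : Function.Injective t) {a : ℝ}
    (h : ∀ k : ℕ, k < N → ∃ i, t i = a + k) (i : Fin N) : ∃ k : ℕ, k < N ∧ t i = a + k := by
  classical
  set S : Finset ℝ := (Finset.univ : Finset (Fin N)).image fun k : Fin N => a + ((k : ℕ) : ℝ)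
    with hS
  have hsub : S ⊆ Finset.univ.image t := by
    intro r hr
    obtain ⟨k, -, rfl⟩ := Finset.mem_image.1 hr
    obtain ⟨i, hi⟩ := h k k.2
    exact Finset.mem_image.2 ⟨i, Finset.mem_univ _, hi⟩
  have hinj : Function.Injective fun k : Fin N => a + ((k : ℕ) : ℝ) := fun k l hkl =>
    Fin.ext (by exact_mod_cast (add_left_cancel hkl : ((k : ℕ) : ℝ) = l))
  have hcard : (Finset.univ.image t).card ≤ S.card := by
    rw [Finset.card_image_of_injective _ ht, hS, Finset.card_image_of_injective _ hinj]
  have heq := Finset.eq_of_subset_of_card_le hsub hcard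
  have hi : t i ∈ S := by rw [heq]; exact Finset.mem_image_of_mem t (Finset.mem_univ i)
  obtain ⟨k, -, hk⟩ := Finset.mem_image.1 hi
  exact ⟨k, k.2, hk.symm⟩

end UnitPairs

/-! ## Sticky energies on the line -/

variable {N : ℕ}

/-- On the line, the contact part of the sticky energy is the number of unit pairs of the
coordinates. [folklore] -/
theorem sum_ite_dist_eq_one (x : Fin N → EuclideanSpace ℝ (Fin 1)) :
    (∑ i, ∑ j ∈ Finset.Ioi i, if dist (x i) (x j) = 1 then (1 : ℝ) else 0) =
      ((unitPairs fun i => x i 0).card : ℝ) := by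
  classical
  rw [← Finset.sum_finset_product' (Finset.univ.filter fun p : Fin N × Fin N => p.1 < p.2)
    Finset.univ (fun i => Finset.Ioi i) (by simp)]
  rw [Finset.sum_boole, unitPairs, Finset.filter_filter]
  congr 2
  ext p
  simp [dist_eq_abs_sub]

/-- **Lower bound**: `N ≥ 1` distinct sticky particles on a line have energy `≥ -(N - 1)`.
[folklore] -/
theorem le_interactionEnergy_stickyPotential {x : Fin N → EuclideanSpace ℝ (Fin 1)}
    (hx : Function.Injective x) (hN : 0 < N) :
    -((N : ℝ) - 1) ≤ interactionEnergy stickyPotential x := by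
  have : Nonempty (Fin N) := ⟨⟨0, hN⟩⟩
  obtain ⟨i₀, -, hi₀⟩ := Finset.exists_max_image Finset.univ (fun i => x i 0) Finset.univ_nonempty
  have hU := card_unitPairs_le (injective_coord hx) (i₀ := i₀) fun j => hi₀ j (Finset.mem_univ j)
  have hU' : ((unitPairs fun i => x i 0).card : ℝ) ≤ (N : ℝ) - 1 := by
    have : ((unitPairs fun i => x i 0).card : ℝ) ≤ ((N - 1 : ℕ) : ℝ) := by exact_mod_cast hU
    rwa [Nat.cast_sub hN, Nat.cast_one] at this
  rw [interactionEnergy_stickyPotential, sum_ite_dist_eq_one]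
  linarith [sum_ite_dist_lt_one_nonneg x]

/-- The unit chain `a, a + 1, …, a + (N - 1)` on the line. [folklore] -/
def chain (N : ℕ) (a : ℝ) : Fin N → EuclideanSpace ℝ (Fin 1) :=
  fun i => EuclideanSpace.single 0 (a + ((i : ℕ) : ℝ))

/-- Coordinates of the chain. [folklore] -/
@[simp] theorem chain_apply (a : ℝ) (i : Fin N) : chain N a i 0 = a + ((i : ℕ) : ℝ) := by
  simp [chain]

/-- The chain consists of distinct points. [folklore] -/
theorem chain_injective (a : ℝ) : Function.Injective (chain N a) := by
  intro i j h
  have := congrArg (fun v : EuclideanSpace ℝ (Fin 1) => v 0) h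
  simp only [chain_apply, add_right_inj, Nat.cast_inj] at this
  exact Fin.ext this

/-- Distances in the chain are differences of indices. [folklore] -/
theorem dist_chain (a : ℝ) (i j : Fin N) :
    dist (chain N a i) (chain N a j) = |((i : ℕ) : ℝ) - ((j : ℕ) : ℝ)| := by
  rw [dist_eq_abs_sub, chain_apply, chain_apply, add_sub_add_left_eq_sub]

/-- All mutual distances in the chain are `≥ 1`. [folklore] -/
theorem one_le_dist_chain (a : ℝ) {i j : Fin N} (h : i ≠ j) :
    1 ≤ dist (chain N a i) (chain N a j) := by
  rw [dist_chain]
  have : (i : ℕ) ≠ (j : ℕ) := Fin.val_ne_of_ne h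
  rcases Nat.lt_or_gt_of_ne this with hlt | hlt
  · have : ((i : ℕ) : ℝ) + 1 ≤ ((j : ℕ) : ℝ) := by exact_mod_cast hlt
    rw [abs_sub_comm, abs_of_nonneg (by linarith)]
    linarith
  · have : ((j : ℕ) : ℝ) + 1 ≤ ((i : ℕ) : ℝ) := by exact_mod_cast hlt
    rw [abs_of_nonneg (by linarith)]
    linarith

/-- The chain of `N ≥ 1` particles has exactly `N - 1` unit pairs. [folklore] -/
theorem card_unitPairs_chain (a : ℝ) (hN : 0 < N) :
    (unitPairs fun i => chain N a i 0).card = N - 1 := by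
  classical
  obtain ⟨n, rfl⟩ : ∃ n, N = n + 1 := ⟨N - 1, by omega⟩
  refine le_antisymm ?_ ?_
  · refine card_unitPairs_le (injective_coord (chain_injective a)) (i₀ := Fin.last n) fun j => ?_
    simp only [chain_apply, add_le_add_iff_left, Nat.cast_le, Fin.val_last]
    exact Fin.is_le j
  · have hinj : Function.Injective fun k : Fin n => (Fin.castSucc k, Fin.succ k) :=
      fun k l h => Fin.castSucc_injective _ (congrArg Prod.fst h)
    have hsub : (Finset.univ.image fun k : Fin n => (Fin.castSucc k, Fin.succ k)) ⊆
        unitPairs fun i => chain (n + 1) a i 0 := by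
      intro p hp
      obtain ⟨k, -, rfl⟩ := Finset.mem_image.1 hp
      refine mem_unitPairs.2 ⟨Fin.castSucc_lt_succ, ?_⟩
      simp only [chain_apply, Fin.val_castSucc, Fin.val_succ, Nat.cast_add, Nat.cast_one]
      rw [abs_of_nonpos (by linarith)]
      ring
    have := Finset.card_le_card hsub
    rw [Finset.card_image_of_injective _ hinj, Finset.card_univ, Fintype.card_fin] at this
    simpa using this

/-- **The chain is optimal**: its sticky energy is `-(N - 1)` (`N ≥ 1`). [folklore] -/
theorem interactionEnergy_chain (a : ℝ) (hN : 0 < N) :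
    interactionEnergy stickyPotential (chain N a) = -((N : ℝ) - 1) := by
  rw [interactionEnergy_stickyPotential, sum_ite_dist_eq_one, card_unitPairs_chain a hN,
    (sum_ite_dist_lt_one_eq_zero_iff _).2 fun i j h => one_le_dist_chain a h,
    Nat.cast_sub hN, Nat.cast_one, zero_sub]

end StickyChain

open StickyChain

/-- **Ground-state energy of `N ≥ 1` sticky particles on a line: `E(N) = -(N - 1)`**.
[folklore] -/
theorem groundStateEnergy_stickyPotential_one {N : ℕ} (hN : 0 < N) :
    groundStateEnergy stickyPotential 1 N = -((N : ℝ) - 1) := by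
  refine le_antisymm ?_ ?_
  · rw [← interactionEnergy_chain 0 hN]
    exact groundStateEnergy_le_of_le _ neg_one_le_stickyPotential (chain_injective 0)
  · have : Nonempty {x : Fin N → EuclideanSpace ℝ (Fin 1) // Function.Injective x} :=
      ⟨⟨chain N 0, chain_injective 0⟩⟩
    exact le_ciInf fun x => le_interactionEnergy_stickyPotential x.2 hN

/-- **Ground states of sticky particles on a line are unit chains**: in a ground state all
mutual distances are `≥ 1`, and the coordinates are `a, a + 1, …, a + (N - 1)` for some `a`
(the one-dimensional case of "the crystallization problem is thus equivalent to the sphere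
packing" for the sticky potential, Blanc–Lewin 2015, §2.3). [folklore] -/
theorem IsGroundState.exists_eq_add_of_stickyPotential {N : ℕ}
    {x : Fin N → EuclideanSpace ℝ (Fin 1)} (hx : IsGroundState stickyPotential x) :
    (∀ i j, i ≠ j → 1 ≤ dist (x i) (x j)) ∧ ∃ a : ℝ, ∀ k : ℕ, k < N → ∃ i, x i 0 = a + k := by
  rcases Nat.eq_zero_or_pos N with hN | hN
  · subst hN
    exact ⟨fun i => Fin.elim0 i, 0, fun k hk => absurd hk (Nat.not_lt_zero k)⟩
  have : Nonempty (Fin N) := ⟨⟨0, hN⟩⟩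
  have ht := injective_coord hx.1
  obtain ⟨i₀, -, hi₀⟩ := Finset.exists_max_image Finset.univ (fun i => x i 0) Finset.univ_nonempty
  obtain ⟨i₁, -, hi₁⟩ := Finset.exists_min_image Finset.univ (fun i => x i 0) Finset.univ_nonempty
  replace hi₀ : ∀ j, x j 0 ≤ x i₀ 0 := fun j => hi₀ j (Finset.mem_univ j)
  replace hi₁ : ∀ j, x i₁ 0 ≤ x j 0 := fun j => hi₁ j (Finset.mem_univ j)
  -- energy bookkeeping: `#core pairs - #unit pairs = E(N) = -(N - 1)` and `#unit pairs ≤ N - 1`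
  have hE : interactionEnergy stickyPotential x ≤ -((N : ℝ) - 1) := by
    rw [hx.2, groundStateEnergy_stickyPotential_one hN]
  rw [interactionEnergy_stickyPotential, sum_ite_dist_eq_one] at hE
  have hU := card_unitPairs_le ht hi₀
  have hU' : ((unitPairs fun i => x i 0).card : ℝ) ≤ (N : ℝ) - 1 := by
    have : ((unitPairs fun i => x i 0).card : ℝ) ≤ ((N - 1 : ℕ) : ℝ) := by exact_mod_cast hU
    rwa [Nat.cast_sub hN, Nat.cast_one] at this
  have hP := sum_ite_dist_lt_one_nonneg x
  have hP0 : (∑ i, ∑ j ∈ Finset.Ioi i, if dist (x i) (x j) < 1 then (1 : ℝ) else 0) = 0 := by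
    linarith
  have hsep := (sum_ite_dist_lt_one_eq_zero_iff x).1 hP0
  have hcard : N - 1 ≤ (unitPairs fun i => x i 0).card := by
    have h2 : (N : ℝ) ≤ (unitPairs fun i => x i 0).card + 1 := by linarith
    have h3 : N ≤ (unitPairs fun i => x i 0).card + 1 := by exact_mod_cast h2
    omega
  refine ⟨hsep, x i₁ 0, exists_apply_eq_min_add hi₀ hi₁
    (fun i hi => exists_apply_eq_add_one ht hi₀ hcard hi) fun i j hij => ?_⟩
  rw [← dist_eq_abs_sub]
  exact hsep i j hij

end Literature.MathematicalPhysics.StatisticalMechanics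

end
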